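import Summits.SmoothPoincare4.SmoothPoincare4.Theorems.SymplecticOrigamiGromovRecognitionRelEndGlueDefs
import Summits.SmoothPoincare4.SmoothPoincare4.Theorems.SymplecticOrigamiGromovRecognitionRelEndGluedBasics
import Summits.SmoothPoincare4.SmoothPoincare4.Theorems.SymplecticOrigamiGromovRecognitionRelEndGluedFamilyHomotopic
import Literature.Geometry.Symplectic.JSphereLocalFoliation
import Literature.Geometry.Symplectic.AdjunctionEmbeddedSpheres

/-!
# Around a leaf, the local foliation is a smooth family of leaves
(registered helper `helper_leaf_chart` of line `cross-cap-laurent`, crux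
`GromovRecognitionRelEnd`, item stmt-SmoothPoincare4-11009; integration lemma L5 of the glue of the
bi-foliation)

Setting: `(X, JX)` a compact almost complex 4-manifold, `F₀ : C(ℂℙ¹, X)` a reference glued map, and
a LEAF `(u, v)` of the family of `F₀` (`IsLeafOf`: an embedded `JX`-holomorphic two-chart sphere
with a trivial-normal-bundle witness `(N, π)` whose glued map `F` is homotopic to `F₀`).  Claim:
the local foliation fact `hls_localFoliation_embeddedSphere_trivialNormal` (a HYPOTHESIS), applied
to `(u, v)` and `(N, π)`, yields a jointly smooth family `(U a, V a)`, `‖a‖ < ε`, through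
`(U 0, V 0) = (u, v)`, with the joint smoothness, disjointness, injective-differential and openness
clauses of the fact, and moreover every member `(U a, V a)` is again a LEAF of the family of `F₀`.

Proof of the last clause: the fact gives that each member is an embedded `JX`-two-chart sphere.
Its glued map `G` exists (`helper_gluedExists`) and is homotopic to `F` through the glued maps of
the family along the segment from `a` to `0` (`helper_gluedFamilyHomotopic`; `F` is a glued map of
the member `0` since `U 0 = u`, `V 0 = v` pointwise), hence `G ∼ F ∼ F₀`.  Finally the member is
somewhere injective (it is embedded: at `z₀ = 0` the differential of `U a` is injective, `U a` is
injective and `V a 0 ∉ range (U a)`), so the adjunction fact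
`adjunction_embedded_of_somewhereInjective_sphere` (a HYPOTHESIS), with reference sphere `(u, v)`,
witness `(N, π)` and the homotopy `G ∼ F`, provides a trivial-normal-bundle witness for it.

References: C. Wendl, *Holomorphic Curves in Low Dimensions*, LNM 2216 (2018), Prop. 2.53,
Thm. 2.49, Cor. 2.52; H. Hofer, V. Lizan, J.-C. Sikorav, J. Geom. Anal. 7 (1997), Thm. 1.  No new
definitions, notation or instances.
-/

noncomputable section

open scoped Manifold ContDiff Topology
open Set Function Filter Literature.Topology.FourManifolds Literature.Topology.FourManifolds.ComplexProjectiveSpace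
  Literature.Geometry.Symplectic

-- the prescribed namespace `Summit.<P>.<Sub>.…` duplicates `SmoothPoincare4` (P = Sub)
set_option linter.dupNamespace false

namespace Summit.SmoothPoincare4.SmoothPoincare4.Theorems.GromovRecognitionRelEnd.CrossCapLaurent

/-- **L5 (registered helper `helper_leaf_chart`): around a leaf, the local foliation fact gives a
smooth family of LEAVES sweeping an open neighbourhood.**  For a leaf `(u, v)` of the family of
`F₀` (`IsLeafOf (fun y => JX y) F₀ u v`), the local foliation fact
`hls_localFoliation_embeddedSphere_trivialNormal` (a hypothesis) yields `ε > 0` and a family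
`(U a, V a)`, `‖a‖ < ε`, with `U 0 = u`, `V 0 = v` pointwise, jointly smooth on `ball 0 ε × ℂ`,
pairwise disjoint, with injective differentials, sweeping out an open set; and every member is a
leaf of the family of `F₀`: embedded by the fact, glued map homotopic to `F₀` through the family
(`helper_gluedFamilyHomotopic`), trivial normal bundle by the adjunction fact
`adjunction_embedded_of_somewhereInjective_sphere` (a hypothesis). -/
theorem helper_leaf_chart : ∀ (X : Type) [TopologicalSpace X] [T2Space X]
    [SecondCountableTopology X] [CompactSpace X] [ConnectedSpace X]
    [ChartedSpace (EuclideanSpace ℝ (Fin 4)) X] [IsManifold (𝓡 4) ∞ X]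
    (JX : AlmostComplexStructure (𝓡 4) ∞ X) (F₀ : C(ComplexProjectiveSpace 1, X)),
    hls_localFoliation_embeddedSphere_trivialNormal →
    adjunction_embedded_of_somewhereInjective_sphere →
    ∀ (u v : ℂ → X), IsLeafOf (fun y => JX y) F₀ u v →
    ∃ (ε : ℝ) (U V : ℂ → ℂ → X), 0 < ε ∧ (∀ z, U 0 z = u z) ∧ (∀ w, V 0 w = v w) ∧
      (∀ a : ℂ, ‖a‖ < ε → IsLeafOf (fun y => JX y) F₀ (U a) (V a)) ∧
      ContMDiffOn 𝓘(ℝ, ℂ × ℂ) (𝓡 4) ∞ (fun q : ℂ × ℂ => U q.1 q.2) (Metric.ball 0 ε ×ˢ univ) ∧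
      ContMDiffOn 𝓘(ℝ, ℂ × ℂ) (𝓡 4) ∞ (fun q : ℂ × ℂ => V q.1 q.2) (Metric.ball 0 ε ×ˢ univ) ∧
      (∀ a a' : ℂ, ‖a‖ < ε → ‖a'‖ < ε → a ≠ a' →
        Disjoint (range (U a) ∪ {V a 0}) (range (U a') ∪ {V a' 0})) ∧
      (∀ q ∈ Metric.ball (0 : ℂ) ε ×ˢ (univ : Set ℂ),
        Injective (mfderiv 𝓘(ℝ, ℂ × ℂ) (𝓡 4) (fun q : ℂ × ℂ => U q.1 q.2) q) ∧
        Injective (mfderiv 𝓘(ℝ, ℂ × ℂ) (𝓡 4) (fun q : ℂ × ℂ => V q.1 q.2) q)) ∧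
      IsOpen (⋃ a ∈ Metric.ball (0 : ℂ) ε, (range (U a) ∪ {V a 0})) := by
  intro X _ _ _ _ _ _ _ JX F₀ hF1 hF4 u v h
  obtain ⟨hS, hE, ⟨N, P, hN⟩, ⟨F, hF, hFF₀⟩⟩ := h
  -- the local foliation around the leaf
  obtain ⟨ε, U, V, hε, hU0, hV0, hleaf, hUs, hVs, hdisj, hinj, hopen, -⟩ :=
    hF1 X JX u v N P hS.smooth_u hS.smooth_v hS.compat hS.hol_u hS.hol_v hE.injective hE.imm_u
      hE.imm_v hE.infty_notMem hN.isOpen hN.image_subset hN.smooth hN.submersive hN.zeroSet_eq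
  refine ⟨ε, U, V, hε, hU0, hV0, fun a ha => ?_, hUs, hVs, hdisj, hinj, hopen⟩
  -- every member `(U a, V a)`, `‖a‖ < ε`, is a leaf of the family of `F₀`
  have hε0 : ‖(0 : ℂ)‖ < ε := by simpa using hε
  have hUV : ∀ a : ℂ, ‖a‖ < ε → ∀ z : ℂ, z ≠ 0 → V a z = U a z⁻¹ :=
    fun a ha => (hleaf a ha).2.2.1
  obtain ⟨hUa, hVa, hcomp, hholU, hholV, hinjU, himmU, himmV, hinf⟩ := hleaf a ha
  -- the glued map `G` of the member `a`
  obtain ⟨G, hG0, hG1⟩ := helper_gluedExists X (U a) (V a) hUa.continuous hVa.continuous hcomp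
  -- `F` is a glued map of the member `0 = (u, v)` (pointwise)
  have hFz : ∀ p, CoordNeZero 0 p → F p = U 0 (affineCoordComplex 0 p 0) := fun p hp => by
    rw [hU0]
    exact hF.chart_zero p hp
  have hFo : ∀ p, CoordNeZero 1 p → F p = V 0 (affineCoordComplex 1 p 0) := fun p hp => by
    rw [hV0]
    exact hF.chart_one p hp
  -- `G ∼ F` through the glued maps of the family along the segment from `a` to `0`
  have hGF : G.Homotopic F :=
    helper_gluedFamilyHomotopic X ε U V a 0 G F ha hε0 hUs.continuousOn hVs.continuousOn hUV hG0
      hG1 hFz hFo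
  -- trivial normal bundle by adjunction: the member is somewhere injective (it is embedded)
  obtain ⟨-, N', P', hN'⟩ := hF4 X JX u v N P (U a) (V a) G F hS.smooth_u hS.smooth_v hS.compat
    hS.hol_u hS.hol_v hE.injective hE.imm_u hE.imm_v hE.infty_notMem hN.isOpen hN.image_subset
    hN.smooth hN.submersive hN.zeroSet_eq hUa hVa hcomp hholU hholV hG0 hG1 hF.chart_zero
    hF.chart_one hGF ⟨0, himmU 0, fun z hz => hinjU hz, fun h0 => hinf ⟨0, h0.symm⟩⟩
  exact ⟨⟨hUa, hVa, hcomp, hholU, hholV⟩, ⟨hinjU, himmU, himmV, hinf⟩,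
    ⟨N', P', (isNormalWitness_iff N' P' (U a) (V a)).2 hN'⟩, ⟨G, ⟨hG0, hG1⟩, hGF.trans hFF₀⟩⟩

end Summit.SmoothPoincare4.SmoothPoincare4.Theorems.GromovRecognitionRelEnd.CrossCapLaurent

end
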